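import Summits.Ventures.YMGap.RobustBall.RobustStarCertificate
import Literature.Probability.LatticeModels.DobrushinShlosmanWeightedStates
import HarnessLib

/-!
# Venture YMGap, track ROBUST-BALL (Y2) — crux Y2-X2-W (the robust vertex-star door on the TIER-2 ball),
# step W3: the STAR-WINDOW DOOR WITH WEIGHTS for a general specification on the links of `(ℤ/L)^d`

HONEST FRAMING. WHAT THIS IS: a venture file (cell `pub-ymgap`, track Y2 ROBUST-BALL, seat ds-2): the weighted
twin of `RobustStarCertificate.spec_star_abs_covariance_le`. There, the vertex-star array `K(s; y → x)` had to be
supported on boundary links within a FINITE radius `ρ₀` of the vertex (the Dobrushin–Shlosman `ℕ`-profile drops by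
one per influence step, so the depth is `⌊L₀/ρ₀⌋`) — which is why an infinite-range (tier-2) member had no star
door. Here the profile is REAL and weighted (Georgii 2011 Rem. 8.26 / Künsch 1982 / Föllmer 1988 Cor. (2.14)
inside the window iteration, `Literature/.../DobrushinShlosmanWeightedStates.lean`): for ANY specification `γ`
on the links of the torus, ANY Gibbs measure `μ` of `γ`, an array `K ≥ 0` of ARBITRARY support with the window
contraction (H1) for the star windows and the `e^{t·reach}`-WEIGHTED per-star received sum
`Σ_y K(s; y → x) e^{t · max_{w ∈ ends y} ‖s − w‖_∞} ≤ ρ < 1` (`x` a star link of `s`, `t ≥ 0`), admissible link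
observables `f, g` whose links' endpoints are `≥ L₀` apart satisfy
`|cov_μ(f, g)| ≤ 2 R² e^{−t L₀} (Σ δf)(Σ δg)` (`spec_star_abs_covariance_le_weighted`) — rate `t` per lattice
unit of the sup-distance, no radius. Consumed by `RobustStarDoorW.lean`. WHAT THIS IS NOT: no array is constructed
here and no number; lattice bookkeeping on a finite torus — nothing about the continuum or the Millennium problem.

## References
* H.-O. Georgii (2011) Remark 8.26; H. Künsch, CMP 84 (1982); H. Föllmer, LNM 1362 (1988) Ch. I (2.13)–(2.14);
  R. L. Dobrushin, S. B. Shlosman (1985).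
* The tree: `RobustStarCertificate.lean` (this seat, g7; followed line by line), `Thresholds/StarWindow.lean`.
-/

noncomputable section

open MeasureTheory ProbabilityTheory Function Finset
open Literature.Probability.LatticeModels
open Literature.Probability.LatticeModels.DobrushinMetric
open Literature.MathematicalPhysics.QuantumFieldTheory
open Literature.MathematicalPhysics.QuantumFieldTheory.Balaban1983to89.StrongCouplingTorusWindow
open Summit.Ventures.YMGap.DSWindow

namespace Summit.Ventures.YMGap.RobustStar

section Door

variable {d L : ℕ} [NeZero L] {G : Type*} [MeasurableSpace G]

/-- **THE STAR-WINDOW DOOR WITH WEIGHTS (general specification, arbitrary support of the array).** Let `γ` be a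
specification on the links of `(ℤ/L)^d` with `G`-valued spins, `μ` a Gibbs measure of `γ`, `r ≤ R` a weight on `G`
(`R ≥ 0`), `K(s; y → x) ≥ 0` a vertex-indexed array satisfying the window contraction (H1) for the star windows of
`γ` (`IsWindowKRContraction γ id (linkWeight r) starWin starWin (K ·.1)`) and, for some `t ≥ 0` and `ρ < 1`, the
WEIGHTED per-star received sum `Σ_y K(s; y → x) · exp(t · max_{w ∈ ends y} ‖s − w‖_∞) ≤ ρ` for `x ∈ vertexStar s`.
Then for admissible link observables `f, g` whose links' endpoints are `≥ L₀` apart,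
`|cov_μ(f, g)| ≤ 2 R² exp(−t L₀) (Σ δf)(Σ δg)` — `DobrushinShlosman.abs_covariance_le_window_exp_profile` with
cells = links, the star windows, the profile `min_{v ∈ ends x} dist(v, ends Δg)` and the reach
`max_{w ∈ ends y} ‖s − w‖_∞`. [folklore] -/
theorem spec_star_abs_covariance_le_weighted {γ : Specification (Edge d L) G} (hγ : IsSpecification γ)
    {μ : Measure (GaugeConfig d L G)} (hμ : IsGibbsMeasure γ μ)
    {r : G → G → ℝ} {R : ℝ} (hR : 0 ≤ R) (hrR : ∀ a b, r a b ≤ R)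
    {K : Site d L → Edge d L → Edge d L → ℝ} (hK : ∀ s y x, 0 ≤ K s y x)
    (hcontract : IsWindowKRContraction γ (id : Edge d L → Edge d L) (linkWeight r) starWin starWin fun c => K c.1)
    {ρ t : ℝ} (hρ0 : 0 ≤ ρ) (hρ1 : ρ < 1) (ht : 0 ≤ t)
    (hsumw : ∀ (s : Site d L) (x : Edge d L), x ∈ vertexStar s →
      ∑ y, K s y x * Real.exp (t * (((linkEnds y).sup fun w => torusNorm (s - w) : ℕ) : ℝ)) ≤ ρ)
    {f g : GaugeConfig d L G → ℝ} {Δf Δg : Finset (Edge d L)} {δf δg : Edge d L → ℝ}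
    (hf : LinkObs r f Δf δf) (hg : LinkObs r g Δg δg) (L₀ : ℕ)
    (hL₀ : ∀ x ∈ Δf, ∀ z ∈ Δg, ∀ a ∈ linkEnds x, ∀ w ∈ linkEnds z, L₀ ≤ torusNorm (a - w)) :
    |cov[f, g; μ]| ≤ 2 * R ^ 2 * Real.exp (-(t * L₀)) * (∑ x ∈ Δf, δf x) * ∑ y ∈ Δg, δg y := by
  classical
  obtain ⟨Bf, hBf⟩ := hf.bounded
  obtain ⟨Bg, hBg⟩ := hg.bounded
  -- the cell data: cells = links, windows = vertex stars, weight = link weight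
  have hwR : ∀ (c : Edge d L) (σ τ : GaugeConfig d L G), linkWeight r c σ τ ≤ R := fun _ _ _ => hrR _ _
  have hwloc : ∀ (c : Edge d L) (σ σ' τ τ' : GaugeConfig d L G), (∀ v, id v = c → σ v = σ' v) →
      (∀ v, id v = c → τ v = τ' v) → linkWeight r c σ τ = linkWeight r c σ' τ' :=
    fun c σ σ' τ τ' hσ hτ => by simp only [linkWeight, hσ c rfl, hτ c rfl]
  have hΛ : ∀ (c v : Edge d L), v ∈ starWin c ↔ id v ∈ starWin c := fun _ _ => Iff.rfl
  have hk : ∀ (c y x : Edge d L), 0 ≤ K c.1 y x := fun c y x => hK c.1 y x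
  -- the reach of a boundary link from a vertex, and the key function
  set reach : Site d L → Edge d L → ℕ := fun s y => (linkEnds y).sup fun w => torusNorm (s - w) with hreach
  have key : ∀ (ρf : Edge d L → ℝ), (∀ x, (∀ c, x ∈ starWin c → ∃ z ∈ starWin c, z ∈ Δg) → ρf x ≤ 0) →
      (∀ c, (∀ z ∈ starWin c, z ∉ Δg) → ∀ x ∈ starWin c, ∀ y, K c.1 y x ≠ 0 →
        ρf x ≤ ρf y + (reach c.1 y : ℝ)) →
      (∀ x ∈ Δf, (L₀ : ℝ) ≤ ρf x) →
      |cov[f, g; μ]| ≤ 2 * R ^ 2 * Real.exp (-(t * L₀)) * (∑ x ∈ Δf, δf x) * ∑ y ∈ Δg, δg y := by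
    intro ρf hρ0' hρ' hm
    exact DobrushinShlosman.abs_covariance_le_window_exp_profile (cell := (id : Edge d L → Edge d L))
      (w := linkWeight r) (Λ := starWin) (win := starWin) (k := fun c => K c.1) hR hwR hwloc hγ hΛ hk hcontract
      hμ hf.measurable hg.measurable hBf hBg hf.dependsOn hg.dependsOn hf.nonneg hf.lip hg.nonneg hg.lip
      hρ0 hρ1 ht (dd := fun c y _ => (reach c.1 y : ℝ)) (fun _ _ _ => Nat.cast_nonneg _) hρ0' hρ'
      (fun c _ x hx => hsumw c.1 x hx) hm
  rcases Δg.eq_empty_or_nonempty with hΔg | hne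
  · -- no `g`-links: the constant profile `L₀`
    refine key (fun _ => (L₀ : ℝ)) (fun x hx => ?_) (fun c _ x _ y _ => ?_) (fun x _ => le_rfl)
    · obtain ⟨z, -, hz⟩ := hx x (self_mem_starWin x)
      rw [hΔg] at hz
      exact absurd hz (Finset.notMem_empty z)
    · have : (0 : ℝ) ≤ reach c.1 y := Nat.cast_nonneg _
      linarith
  · -- the distance-to-`Δg` function on sites and the induced link profile
    set D : Site d L → ℕ := fun s => Δg.inf' hne fun z => (linkEnds z).inf' (linkEnds_nonempty z)
      fun w => torusNorm (s - w) with hD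
    have hD0 : ∀ z ∈ Δg, ∀ w ∈ linkEnds z, D w = 0 := by
      intro z hz w hw
      apply Nat.eq_zero_of_le_zero
      calc D w ≤ (linkEnds z).inf' (linkEnds_nonempty z) fun w' => torusNorm (w - w') := Finset.inf'_le _ hz
        _ ≤ torusNorm (w - w) := Finset.inf'_le _ hw
        _ = 0 := by rw [sub_self, torusNorm_zero]
    have hDlip : ∀ s w, D s ≤ D w + torusNorm (s - w) := by
      intro s w
      obtain ⟨z, hz, hzeq⟩ := Finset.exists_mem_eq_inf' hne fun z =>
        (linkEnds z).inf' (linkEnds_nonempty z) fun w' => torusNorm (w - w')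
      obtain ⟨w', hw', hweq⟩ := Finset.exists_mem_eq_inf' (linkEnds_nonempty z) fun w' => torusNorm (w - w')
      have hDw : D w = torusNorm (w - w') := by rw [hD]; exact hzeq.trans hweq
      rw [hDw]
      calc D s ≤ (linkEnds z).inf' (linkEnds_nonempty z) fun w'' => torusNorm (s - w'') := Finset.inf'_le _ hz
        _ ≤ torusNorm (s - w') := Finset.inf'_le _ hw'
        _ ≤ torusNorm (s - w) + torusNorm (w - w') := torusNorm_sub_le _ _ _
        _ = torusNorm (w - w') + torusNorm (s - w) := add_comm _ _
    have hDL : ∀ x ∈ Δf, ∀ v ∈ linkEnds x, L₀ ≤ D v := fun x hx v hv =>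
      Finset.le_inf' _ _ fun z hz => Finset.le_inf' _ _ fun w hw => hL₀ x hx z hz v hv w hw
    set ρf : Edge d L → ℝ := fun x => (((linkEnds x).inf' (linkEnds_nonempty x) D : ℕ) : ℝ) with hρf
    refine key ρf (fun x hx => ?_) (fun c _ x hxc y _ => ?_) (fun x hx => ?_)
    · -- a link all of whose stars meet `Δg` has an endpoint at distance `0`
      obtain ⟨z, hzc, hzg⟩ := hx x (self_mem_starWin x)
      have h1 : x.1 ∈ linkEnds z := mem_starWin.1 hzc
      have h0 : (linkEnds x).inf' (linkEnds_nonempty x) D = 0 := by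
        apply Nat.eq_zero_of_le_zero
        calc (linkEnds x).inf' (linkEnds_nonempty x) D ≤ D x.1 := Finset.inf'_le _ (fst_mem_linkEnds x)
          _ = 0 := hD0 z hzg x.1 h1
      simp only [hρf, h0, Nat.cast_zero, le_refl]
    · -- one step of influence: the profile drops by at most the reach of `y` from the vertex
      have h1 : c.1 ∈ linkEnds x := mem_starWin.1 hxc
      obtain ⟨w, hw, hweq⟩ := Finset.exists_mem_eq_inf' (linkEnds_nonempty y) D
      have hnat : (linkEnds x).inf' (linkEnds_nonempty x) D ≤ (linkEnds y).inf' (linkEnds_nonempty y) D + reach c.1 y := by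
        rw [hweq]
        calc (linkEnds x).inf' (linkEnds_nonempty x) D ≤ D c.1 := Finset.inf'_le _ h1
          _ ≤ D w + torusNorm (c.1 - w) := hDlip _ _
          _ ≤ D w + reach c.1 y := Nat.add_le_add_left (Finset.le_sup (f := fun w => torusNorm (c.1 - w)) hw) _
      have := (Nat.cast_le (α := ℝ)).2 hnat
      simp only [hρf]
      push_cast at this ⊢
      exact this
    · -- the profile is `≥ L₀` on `Δf`
      simp only [hρf]
      exact_mod_cast Finset.le_inf' _ _ fun a ha => hDL x hx a ha

end Door

end Summit.Ventures.YMGap.RobustStar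

end
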